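import Literature.MathematicalPhysics.QuantumFieldTheory.SlabTransferKernel
import Literature.Analysis.OperatorTheory.PositiveKernelNormLogConvex
import HarnessLib

/-!
# The transfer kernel of the Wilson action is log-convex in the couplings; log-convexity of the top
# of the transfer operator in `(J_E, J_M)` — PROVED

Topic `Literature/MathematicalPhysics/QuantumFieldTheory`; companion of `SlabTransferKernel.lean` (the
symmetrised time-slice kernel `sliceKernel ρ J_E J_M a b = e^{J_M magSum a/2} (∫ e^{J_E elecSum(a,E,b)} dE)
e^{J_M magSum b/2}` of the Wilson lattice gauge theory with ANISOTROPIC couplings `J_E` (temporal /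
electric plaquettes) and `J_M` (spatial / magnetic plaquettes) on the spatial torus `(ℤ/L)^d`) and of
`Literature/Analysis/OperatorTheory/PositiveKernelNormLogConvex.lean` (Kingman's theorem for the norm of
positive-kernel operators; the secant bracket). Theorems only; no definition, no named fact.

* `sliceKernel_nonneg` — `0 ≤ sliceKernel`.
* `integral_exp_mul_convexComb_le` — HÖLDER: `∫ e^{(θs+(1-θ)t) q} dν ≤ (∫ e^{s q} dν)^θ (∫ e^{t q} dν)^{1-θ}`,
  i.e. `J ↦ log ∫ e^{J q} dν` is convex (the convexity of a log-partition / cumulant generating function;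
  Rogers–Hölder inequality [cite: Dudley2002, §5.1 Thm. 5.1.2]).
* `sliceKernel_convexComb_le` — **pointwise joint log-convexity in the couplings**:
  `sliceKernel ρ (θJ_E + (1-θ)J_E') (θJ_M + (1-θ)J_M') a b ≤ (sliceKernel ρ J_E J_M a b)^θ (sliceKernel ρ J_E' J_M' a b)^{1-θ}`
  (the magnetic factors are log-affine, the electric factor is Hölder).
* `norm_sliceKernelOp_convexComb_le`, **`convexOn_log_norm_sliceKernelOp`** — for ANY family of bounded
  operators `T (J_E, J_M)` on `L²(μ)` (`μ` a finite, non-zero measure on the slice configurations, e.g.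
  the product Haar measure) given a.e. by the kernels `sliceKernel ρ J_E J_M`:
  `‖T(θJ + (1-θ)J′)‖ ≤ ‖T J‖^θ ‖T J′‖^{1-θ}` and `(J_E, J_M) ↦ log ‖T(J_E, J_M)‖` is CONVEX on `ℝ²`
  (Kingman); `convexOn_log_norm_sliceKernelOp_elec/_mag` are the one-coupling restrictions. For the
  positive self-adjoint transfer operator `‖T‖ = λ₀` is the top of the spectrum, so this is the convexity
  of `ln λ₀` in the couplings — the limit form of the convexity of `ln Z` of the anisotropic Wilson action
  (`Z_{Λ×L₀} = Tr T^{L₀}`, `integral_obs_mul_weight_eq_integral_sliceKernel`), obtained here directly,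
  without the thermodynamic limit in time and without any simplicity of `λ₀`.

HONEST FRAMING: finite spatial torus, pure operator theory; nothing about `L → ∞`, the continuum or a
mass gap. Application (pub-ymgap track Y3): with `PositiveKernelNormLogConvex.log_norm_secant_bracket`,
certified enclosures of `λ₀` at `J ± h` give two chords that RIGOROUSLY enclose a Hellmann–Feynman
plaquette expectation at `J` ("secant-convex" certificates), see that file.

## References

* J. F. C. Kingman, Quart. J. Math. Oxford (2) 12 (1961) 283–284 (log-convexity of the Perron root).
  [Kingman1961]
* K. Bogdanović, A. Peperko, Positivity 26 (2022), Thm. 1.1 (i) (norm and spectral radius of Hadamard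
  weighted geometric means of positive kernel operators). [BogdanovicPeperko2022]
* R. M. Dudley, *Real Analysis and Probability* (2002), §5.1 (Hölder), §6.3 (convex functions). [Dudley2002]
* K. Osterwalder, E. Seiler, Ann. Phys. 110 (1978) 440, §2–3 (the transfer matrix of lattice gauge
  theory). [OsterwalderSeiler1978]
-/

noncomputable section

open MeasureTheory Set Filter Function Topology
open scoped RealInnerProductSpace ENNReal

namespace Literature.MathematicalPhysics.QuantumFieldTheory

open Literature.Analysis.OperatorTheory

/-! ### Hölder: `J ↦ ∫ e^{J q} dν` is log-convex -/

section Holder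

variable {Y : Type*} [MeasurableSpace Y] {ν : Measure Y}

/-- **Hölder's inequality in log-convexity form**: for a real function `q` and couplings `s, t`,
`∫ e^{(θ s + (1-θ) t) q} dν ≤ (∫ e^{s q} dν)^θ (∫ e^{t q} dν)^{1-θ}` (`0 ≤ θ ≤ 1`), provided the three
exponentials are integrable. Equivalently `J ↦ log ∫ e^{J q} dν` is convex.
[cite: Dudley2002, §5.1 Thm. 5.1.2 (Hölder)] -/
theorem integral_exp_mul_convexComb_le (q : Y → ℝ) {s t θ : ℝ} (hθ₀ : 0 ≤ θ) (hθ₁ : θ ≤ 1)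
    (hs : Integrable (fun y => Real.exp (s * q y)) ν) (ht : Integrable (fun y => Real.exp (t * q y)) ν)
    (hm : Integrable (fun y => Real.exp ((θ * s + (1 - θ) * t) * q y)) ν) :
    ∫ y, Real.exp ((θ * s + (1 - θ) * t) * q y) ∂ν ≤
      (∫ y, Real.exp (s * q y) ∂ν) ^ θ * (∫ y, Real.exp (t * q y) ∂ν) ^ (1 - θ) := by
  have hθ₁' : 0 ≤ 1 - θ := sub_nonneg.mpr hθ₁
  -- pointwise: `e^{(θs+(1-θ)t)q} = (e^{sq})^θ (e^{tq})^{1-θ}`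
  have hpt : ∀ y, Real.exp ((θ * s + (1 - θ) * t) * q y) =
      Real.exp (s * q y) ^ θ * Real.exp (t * q y) ^ (1 - θ) := by
    intro y
    rw [← Real.exp_mul, ← Real.exp_mul, ← Real.exp_add]
    congr 1
    ring
  have hms : AEMeasurable (fun y => ENNReal.ofReal (Real.exp (s * q y))) ν :=
    hs.aestronglyMeasurable.aemeasurable.ennreal_ofReal
  have hmt : AEMeasurable (fun y => ENNReal.ofReal (Real.exp (t * q y))) ν :=
    ht.aestronglyMeasurable.aemeasurable.ennreal_ofReal
  have hH : ∫⁻ y, ENNReal.ofReal (Real.exp ((θ * s + (1 - θ) * t) * q y)) ∂ν ≤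
      (∫⁻ y, ENNReal.ofReal (Real.exp (s * q y)) ∂ν) ^ θ *
        (∫⁻ y, ENNReal.ofReal (Real.exp (t * q y)) ∂ν) ^ (1 - θ) := by
    calc ∫⁻ y, ENNReal.ofReal (Real.exp ((θ * s + (1 - θ) * t) * q y)) ∂ν
        = ∫⁻ y, ENNReal.ofReal (Real.exp (s * q y)) ^ θ * ENNReal.ofReal (Real.exp (t * q y)) ^ (1 - θ) ∂ν := by
          refine lintegral_congr fun y => ?_
          rw [hpt y, ENNReal.ofReal_mul (Real.rpow_nonneg (Real.exp_pos _).le θ),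
            ENNReal.ofReal_rpow_of_nonneg (Real.exp_pos _).le hθ₀,
            ENNReal.ofReal_rpow_of_nonneg (Real.exp_pos _).le hθ₁']
      _ ≤ _ := ENNReal.lintegral_mul_norm_pow_le hms hmt hθ₀ hθ₁' (by ring)
  have e := ofReal_integral_eq_lintegral_ofReal hm (Eventually.of_forall fun y => (Real.exp_pos _).le)
  have es := ofReal_integral_eq_lintegral_ofReal hs (Eventually.of_forall fun y => (Real.exp_pos _).le)
  have et := ofReal_integral_eq_lintegral_ofReal ht (Eventually.of_forall fun y => (Real.exp_pos _).le)
  have hIs : 0 ≤ ∫ y, Real.exp (s * q y) ∂ν := integral_nonneg fun y => (Real.exp_pos _).le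
  have hIt : 0 ≤ ∫ y, Real.exp (t * q y) ∂ν := integral_nonneg fun y => (Real.exp_pos _).le
  rw [← e, ← es, ← et, ENNReal.ofReal_rpow_of_nonneg hIs hθ₀, ENNReal.ofReal_rpow_of_nonneg hIt hθ₁',
    ← ENNReal.ofReal_mul (Real.rpow_nonneg hIs θ)] at hH
  exact (ENNReal.ofReal_le_ofReal_iff (by positivity)).mp hH

end Holder

/-! ### The slice kernel is non-negative and jointly log-convex in `(J_E, J_M)` -/

section Kernel

variable {d L : ℕ} {G : Type*} [Group G] [TopologicalSpace G] [IsTopologicalGroup G] [CompactSpace G]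
  [MeasurableSpace G] [BorelSpace G] {N : ℕ} (ρ : G →* Matrix (Fin N) (Fin N) ℂ)

/-- `0 ≤ sliceKernel ρ J_E J_M a b` (a product of exponentials and an integral of exponentials).
[cite: OsterwalderSeiler1978, §2–3] -/
theorem sliceKernel_nonneg [NeZero L] (JE JM : ℝ) (a b : (Fin d → ZMod L) × Fin d → G) :
    0 ≤ sliceKernel ρ JE JM a b := by
  unfold sliceKernel
  exact mul_nonneg (mul_nonneg (Real.exp_pos _).le (integral_nonneg fun E => (Real.exp_pos _).le))
    (Real.exp_pos _).le

variable [SecondCountableTopology G]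

/-- The temporal-link integrand `E ↦ e^{J elecSum(a, E, b)}` is integrable against the product Haar
probability measure (continuous on a compact group). [folklore] -/
private theorem integrable_exp_mul_elecSum [NeZero L] (hρ : Continuous ρ) (J : ℝ)
    (a b : (Fin d → ZMod L) × Fin d → G) :
    Integrable (fun E : (Fin d → ZMod L) → G => Real.exp (J * elecSum ρ a E b))
      (Measure.pi fun _ : Fin d → ZMod L => haarProbability G) := by
  have hq := continuous_elecSum (d := d) (L := L) ρ hρ
  have h1 : Continuous fun E : (Fin d → ZMod L) → G =>
      (((a, b) : ((Fin d → ZMod L) × Fin d → G) × ((Fin d → ZMod L) × Fin d → G)), E) :=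
    continuous_const.prodMk continuous_id
  have h2 := hq.comp h1
  simp only [Function.comp_def] at h2
  have hFc : Continuous fun E : (Fin d → ZMod L) → G => Real.exp (J * elecSum ρ a E b) :=
    Real.continuous_exp.comp (continuous_const.mul h2)
  exact hFc.integrable_of_hasCompactSupport
    (IsCompact.of_isClosed_subset isCompact_univ (isClosed_tsupport _) (Set.subset_univ _))

/-- **The slice kernel is jointly log-convex in the couplings** (pointwise in the two slice
configurations): for `0 ≤ θ ≤ 1`,
`sliceKernel ρ (θJ_E + (1-θ)J_E') (θJ_M + (1-θ)J_M') a b ≤ (sliceKernel ρ J_E J_M a b)^θ (sliceKernel ρ J_E' J_M' a b)^{1-θ}`.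
The two magnetic factors `e^{J_M magSum/2}` are log-affine in `J_M`; the electric factor
`∫ e^{J_E elecSum} dE` is log-convex in `J_E` by Hölder (`integral_exp_mul_convexComb_le`).
[cite: Kingman1961, Theorem (hypothesis: log-convex entries)] [cite: Dudley2002, §5.1 Thm. 5.1.2] -/
theorem sliceKernel_convexComb_le [NeZero L] (hρ : Continuous ρ) {θ : ℝ} (hθ₀ : 0 ≤ θ) (hθ₁ : θ ≤ 1)
    (JE JM JE' JM' : ℝ) (a b : (Fin d → ZMod L) × Fin d → G) :
    sliceKernel ρ (θ * JE + (1 - θ) * JE') (θ * JM + (1 - θ) * JM') a b ≤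
      sliceKernel ρ JE JM a b ^ θ * sliceKernel ρ JE' JM' a b ^ (1 - θ) := by
  have hθ₁' : 0 ≤ 1 - θ := sub_nonneg.mpr hθ₁
  unfold sliceKernel
  set I : ℝ → ℝ := fun J => ∫ E, Real.exp (J * elecSum ρ a E b)
    ∂(Measure.pi fun _ : Fin d → ZMod L => haarProbability G) with hI
  have hI0 : ∀ J, 0 ≤ I J := fun J => integral_nonneg fun E => (Real.exp_pos _).le
  have hHolder : I (θ * JE + (1 - θ) * JE') ≤ I JE ^ θ * I JE' ^ (1 - θ) :=
    integral_exp_mul_convexComb_le (fun E => elecSum ρ a E b) hθ₀ hθ₁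
      (integrable_exp_mul_elecSum ρ hρ JE a b) (integrable_exp_mul_elecSum ρ hρ JE' a b)
      (integrable_exp_mul_elecSum ρ hρ _ a b)
  -- log-affine magnetic factors
  have hexp : ∀ m : ℝ, Real.exp ((θ * JM + (1 - θ) * JM') / 2 * m) =
      Real.exp (JM / 2 * m) ^ θ * Real.exp (JM' / 2 * m) ^ (1 - θ) := by
    intro m
    rw [← Real.exp_mul, ← Real.exp_mul, ← Real.exp_add]
    congr 1
    ring
  change Real.exp ((θ * JM + (1 - θ) * JM') / 2 * magSum ρ a) * I (θ * JE + (1 - θ) * JE') *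
      Real.exp ((θ * JM + (1 - θ) * JM') / 2 * magSum ρ b) ≤
    (Real.exp (JM / 2 * magSum ρ a) * I JE * Real.exp (JM / 2 * magSum ρ b)) ^ θ *
      (Real.exp (JM' / 2 * magSum ρ a) * I JE' * Real.exp (JM' / 2 * magSum ρ b)) ^ (1 - θ)
  rw [hexp, hexp, Real.mul_rpow (mul_nonneg (Real.exp_pos _).le (hI0 _)) (Real.exp_pos _).le,
    Real.mul_rpow (Real.exp_pos _).le (hI0 _),
    Real.mul_rpow (mul_nonneg (Real.exp_pos _).le (hI0 _)) (Real.exp_pos _).le,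
    Real.mul_rpow (Real.exp_pos _).le (hI0 _)]
  have hA : 0 ≤ Real.exp (JM / 2 * magSum ρ a) ^ θ * Real.exp (JM' / 2 * magSum ρ a) ^ (1 - θ) := by
    positivity
  have hB : 0 ≤ Real.exp (JM / 2 * magSum ρ b) ^ θ * Real.exp (JM' / 2 * magSum ρ b) ^ (1 - θ) := by
    positivity
  calc Real.exp (JM / 2 * magSum ρ a) ^ θ * Real.exp (JM' / 2 * magSum ρ a) ^ (1 - θ) *
        I (θ * JE + (1 - θ) * JE') *
        (Real.exp (JM / 2 * magSum ρ b) ^ θ * Real.exp (JM' / 2 * magSum ρ b) ^ (1 - θ))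
      ≤ Real.exp (JM / 2 * magSum ρ a) ^ θ * Real.exp (JM' / 2 * magSum ρ a) ^ (1 - θ) *
        (I JE ^ θ * I JE' ^ (1 - θ)) *
        (Real.exp (JM / 2 * magSum ρ b) ^ θ * Real.exp (JM' / 2 * magSum ρ b) ^ (1 - θ)) := by
        gcongr
    _ = Real.exp (JM / 2 * magSum ρ a) ^ θ * I JE ^ θ * Real.exp (JM / 2 * magSum ρ b) ^ θ *
        (Real.exp (JM' / 2 * magSum ρ a) ^ (1 - θ) * I JE' ^ (1 - θ) *
          Real.exp (JM' / 2 * magSum ρ b) ^ (1 - θ)) := by ring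

/-- The same inequality for coupling PAIRS `J = (J_E, J_M) ∈ ℝ²` and their convex combination
`θ • J + (1-θ) • J′` (the hypothesis shape of `convexOn_log_norm_kernelOp`). [cite: Kingman1961, Theorem] -/
theorem sliceKernel_smul_add_smul_le [NeZero L] (hρ : Continuous ρ) (J J' : ℝ × ℝ) {θ : ℝ} (hθ₀ : 0 ≤ θ)
    (hθ₁ : θ ≤ 1) (a b : (Fin d → ZMod L) × Fin d → G) :
    sliceKernel ρ (θ • J + (1 - θ) • J').1 (θ • J + (1 - θ) • J').2 a b ≤
      sliceKernel ρ J.1 J.2 a b ^ θ * sliceKernel ρ J'.1 J'.2 a b ^ (1 - θ) := by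
  simpa only [Prod.fst_add, Prod.snd_add, Prod.smul_fst, Prod.smul_snd, smul_eq_mul] using
    sliceKernel_convexComb_le ρ hρ hθ₀ hθ₁ J.1 J.2 J'.1 J'.2 a b

/-! ### Kingman for the transfer operators: `(J_E, J_M) ↦ log ‖T(J_E, J_M)‖` is convex -/

variable {μ : Measure ((Fin d → ZMod L) × Fin d → G)} [IsFiniteMeasure μ]

/-- **Two-point Kingman inequality for the transfer operators.** Let `T J` (`J = (J_E, J_M) ∈ ℝ²`) be
bounded operators on `L²(μ)` (`μ` any finite measure on the slice configurations) given a.e. by the slice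
kernels, `(T J φ)(a) = ∫ sliceKernel ρ J_E J_M a b φ(b) dμ(b)`. Then for `0 ≤ θ ≤ 1`,
`‖T(θJ + (1-θ)J′)‖ ≤ ‖T J‖^θ ‖T J′‖^{1-θ}`. [cite: Kingman1961, Theorem]
[cite: BogdanovicPeperko2022, Thm. 1.1 (i)] -/
theorem norm_sliceKernelOp_convexComb_le [NeZero L] (hρ : Continuous ρ)
    {T : ℝ × ℝ → Lp ℝ 2 μ →L[ℝ] Lp ℝ 2 μ}
    (hT : ∀ J : ℝ × ℝ, ∀ φ : Lp ℝ 2 μ, (T J φ : ((Fin d → ZMod L) × Fin d → G) → ℝ) =ᵐ[μ]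
      fun a => ∫ b, sliceKernel ρ J.1 J.2 a b * φ b ∂μ)
    (J J' : ℝ × ℝ) {θ : ℝ} (hθ₀ : 0 ≤ θ) (hθ₁ : θ ≤ 1) :
    ‖T (θ • J + (1 - θ) • J')‖ ≤ ‖T J‖ ^ θ * ‖T J'‖ ^ (1 - θ) :=
  norm_kernelOp_convexComb_le (D := univ) (K := fun J : ℝ × ℝ => sliceKernel ρ J.1 J.2)
    (fun J _ => (continuous_sliceKernel (d := d) (L := L) ρ hρ J.1 J.2).stronglyMeasurable)
    (fun J _ => exists_sliceKernel_le (d := d) (L := L) ρ hρ J.1 J.2) (fun J _ => sliceKernel_nonneg ρ J.1 J.2)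
    (fun J _ => hT J) (fun J _ J' _ _ hθ₀ hθ₁ a b => sliceKernel_smul_add_smul_le ρ hρ J J' hθ₀ hθ₁ a b)
    convex_univ (mem_univ J) (mem_univ J') hθ₀ hθ₁

/-- **Kingman's log-convexity of the top of the transfer operator in the couplings.** With `T` as in
`norm_sliceKernelOp_convexComb_le` and `μ ≠ 0`, the function `(J_E, J_M) ↦ log ‖T(J_E, J_M)‖` is CONVEX on
`ℝ²` (every `T J ≠ 0` because the kernel is strictly positive, `sliceKernel_pos`). For the positive
self-adjoint transfer operator of the Wilson action `‖T‖ = λ₀` is the top of its spectrum.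
[cite: Kingman1961, Theorem] [cite: BogdanovicPeperko2022, Thm. 1.1 (i)] -/
theorem convexOn_log_norm_sliceKernelOp [NeZero L] (hρ : Continuous ρ) (hμ : μ ≠ 0)
    {T : ℝ × ℝ → Lp ℝ 2 μ →L[ℝ] Lp ℝ 2 μ}
    (hT : ∀ J : ℝ × ℝ, ∀ φ : Lp ℝ 2 μ, (T J φ : ((Fin d → ZMod L) × Fin d → G) → ℝ) =ᵐ[μ]
      fun a => ∫ b, sliceKernel ρ J.1 J.2 a b * φ b ∂μ) :
    ConvexOn ℝ univ (fun J : ℝ × ℝ => Real.log ‖T J‖) := by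
  refine convexOn_log_norm_kernelOp (D := univ) (K := fun J : ℝ × ℝ => sliceKernel ρ J.1 J.2)
    (fun J _ => (continuous_sliceKernel (d := d) (L := L) ρ hρ J.1 J.2).stronglyMeasurable)
    (fun J _ => exists_sliceKernel_le (d := d) (L := L) ρ hρ J.1 J.2) (fun J _ => sliceKernel_nonneg ρ J.1 J.2)
    (fun J _ => hT J) (fun J _ J' _ _ hθ₀ hθ₁ a b => sliceKernel_smul_add_smul_le ρ hρ J J' hθ₀ hθ₁ a b)
    convex_univ fun J _ => ?_
  obtain ⟨C, hC⟩ := exists_sliceKernel_le (d := d) (L := L) ρ hρ J.1 J.2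
  exact kernelOp_ne_zero (continuous_sliceKernel (d := d) (L := L) ρ hρ J.1 J.2).stronglyMeasurable hC
    (sliceKernel_pos (d := d) (L := L) ρ hρ J.1 J.2) hμ (hT J)

/-- **Convexity in the electric (temporal) coupling at fixed magnetic coupling**: for operators `S J_E`
given a.e. by the kernels `sliceKernel ρ J_E J_M` (`J_M` fixed), `J_E ↦ log ‖S J_E‖` is convex on `ℝ`.
[cite: Kingman1961, Theorem] -/
theorem convexOn_log_norm_sliceKernelOp_elec [NeZero L] (hρ : Continuous ρ) (hμ : μ ≠ 0) (JM : ℝ)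
    {S : ℝ → Lp ℝ 2 μ →L[ℝ] Lp ℝ 2 μ}
    (hS : ∀ JE : ℝ, ∀ φ : Lp ℝ 2 μ, (S JE φ : ((Fin d → ZMod L) × Fin d → G) → ℝ) =ᵐ[μ]
      fun a => ∫ b, sliceKernel ρ JE JM a b * φ b ∂μ) :
    ConvexOn ℝ univ (fun JE : ℝ => Real.log ‖S JE‖) := by
  refine convexOn_log_norm_kernelOp (D := univ) (K := fun JE : ℝ => sliceKernel ρ JE JM)
    (fun JE _ => (continuous_sliceKernel (d := d) (L := L) ρ hρ JE JM).stronglyMeasurable)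
    (fun JE _ => exists_sliceKernel_le (d := d) (L := L) ρ hρ JE JM) (fun JE _ => sliceKernel_nonneg ρ JE JM)
    (fun JE _ => hS JE) (fun JE _ JE' _ θ hθ₀ hθ₁ a b => ?_) convex_univ fun JE _ => ?_
  · have h := sliceKernel_convexComb_le ρ hρ hθ₀ hθ₁ JE JM JE' JM a b
    have e : θ * JM + (1 - θ) * JM = JM := by ring
    rw [e] at h
    simpa only [smul_eq_mul] using h
  · obtain ⟨C, hC⟩ := exists_sliceKernel_le (d := d) (L := L) ρ hρ JE JM
    exact kernelOp_ne_zero (continuous_sliceKernel (d := d) (L := L) ρ hρ JE JM).stronglyMeasurable hC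
      (sliceKernel_pos (d := d) (L := L) ρ hρ JE JM) hμ (hS JE)

/-- **Convexity in the magnetic (spatial) coupling at fixed electric coupling**: for operators `S J_M`
given a.e. by the kernels `sliceKernel ρ J_E J_M` (`J_E` fixed), `J_M ↦ log ‖S J_M‖` is convex on `ℝ`.
[cite: Kingman1961, Theorem] -/
theorem convexOn_log_norm_sliceKernelOp_mag [NeZero L] (hρ : Continuous ρ) (hμ : μ ≠ 0) (JE : ℝ)
    {S : ℝ → Lp ℝ 2 μ →L[ℝ] Lp ℝ 2 μ}
    (hS : ∀ JM : ℝ, ∀ φ : Lp ℝ 2 μ, (S JM φ : ((Fin d → ZMod L) × Fin d → G) → ℝ) =ᵐ[μ]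
      fun a => ∫ b, sliceKernel ρ JE JM a b * φ b ∂μ) :
    ConvexOn ℝ univ (fun JM : ℝ => Real.log ‖S JM‖) := by
  refine convexOn_log_norm_kernelOp (D := univ) (K := fun JM : ℝ => sliceKernel ρ JE JM)
    (fun JM _ => (continuous_sliceKernel (d := d) (L := L) ρ hρ JE JM).stronglyMeasurable)
    (fun JM _ => exists_sliceKernel_le (d := d) (L := L) ρ hρ JE JM) (fun JM _ => sliceKernel_nonneg ρ JE JM)
    (fun JM _ => hS JM) (fun JM _ JM' _ θ hθ₀ hθ₁ a b => ?_) convex_univ fun JM _ => ?_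
  · have h := sliceKernel_convexComb_le ρ hρ hθ₀ hθ₁ JE JM JE JM' a b
    have e : θ * JE + (1 - θ) * JE = JE := by ring
    rw [e] at h
    simpa only [smul_eq_mul] using h
  · obtain ⟨C, hC⟩ := exists_sliceKernel_le (d := d) (L := L) ρ hρ JE JM
    exact kernelOp_ne_zero (continuous_sliceKernel (d := d) (L := L) ρ hρ JE JM).stronglyMeasurable hC
      (sliceKernel_pos (d := d) (L := L) ρ hρ JE JM) hμ (hS JM)

end Kernel

end Literature.MathematicalPhysics.QuantumFieldTheory

end
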